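import Summits.Parity.GeneralizedHardyLittlewood.Theorems.BeyondDiagonalBeatsQuarter.KernelFormXSqCore
import HarnessLib

/-!
# Route `PrimeLevelFamEdge`, crux K_B (stmt-Parity-20343), line `diagonal_kernel_split`, helper H1
# (`CornerNegligibleXSq`), part 3: plain twisted Möbius sums `A_n(y) = Σ_{k ≤ y, (k,n)=1} μ(k)τ(k)/(kψ(k))`

The corner estimate needs the UNWEIGHTED partial sums of the Selberg-coordinate coefficients
`a_n(k) = copTauW n k = τ(k)μ(k)/(kψ(k))·1_{(k,n)=1}` of the landed kernel toolkit
(`KernelFormXSq*`), i.e. the order-two zero of `1/ζ(1+s)²` itself rather than its second Riesz mean: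
* `abs_moebiusSqSum_le` — the hyperbola bound `|Σ_{de ≤ z} μ(d)μ(e)/(de)| ≤ C/(1 + log z)¹²` from the
  tree's de la Vallée-Poussin rate `Σ_{n ≤ x} μ(n)/n ≪ e^{−c√log x}`
  (`abs_sum_moebius_div_le_exp_neg_sqrt_log`);
* `sum_copTauW_eq_sum_hloc` — Dirichlet's rearrangement `A_n(y) = Σ_{m ≤ y} h_n(m)·MM(y/m)` with
  `copTauW n = G ∗ G ∗ hloc n` (`copTauW_eq_G_mul_G_mul_hloc`, `G = μ/id`);
* **`abs_sum_copTauW_le`** — `|A_n(y)| ≤ C·D(n)/(1 + log y)¹²` for all `y ≥ 1`, `n ≥ 1`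
  (`D(n) = Σ_{d∣n} d^{−3/4}`, via `Σ_m |h_n(m)| m^{1/8} ≪ D(n)`).
Helper toward the heart stub (plan Ω, H1); closes nothing; standard axioms.
«The programme SEARCHES and TYPES; no claim about Landau–Siegel zeros, Theorems 1–2 of
arXiv:2211.02515 or a repaired Margin232 until a kernel theorem says so.»
-/

noncomputable section

open scoped Real ArithmeticFunction.Moebius
open Finset ArithmeticFunction

namespace Summit.Parity.GeneralizedHardyLittlewood.Theorems.BeyondDiagonalBeatsQuarter.Corner

open Literature.NumberTheory.LFunctions Literature.NumberTheory.LFunctions.KMV2000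
open MollifierMainTerm (W G invA)
open Literature.Barriers.Parity (Icc_one_eq_Ioc_zero)
open KernelFormXSq

/-! ### Powers of `1 + log` dominate `e^{−c√log}` and negative powers -/

/-- `Σ_{k ≤ e} μ(k)/k ≪ (1 + log e)⁻¹³` for naturals `e ≥ 1`. [cite: MontgomeryVaughan2007, §8.1 (8.6)] -/
theorem abs_sum_moebius_div_le_inv_log_pow_thirteen :
    ∃ C : ℝ, 0 < C ∧ ∀ e : ℕ, 1 ≤ e →
      |∑ k ∈ Icc 1 e, (μ k : ℝ) / k| ≤ C / (1 + Real.log e) ^ 13 := by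
  obtain ⟨c, hc, C, hC⟩ := abs_sum_moebius_div_le_exp_neg_sqrt_log
  obtain ⟨K, hK, hKb⟩ := exp_neg_sqrt_le_div_pow hc 13
  have hC0 : 0 ≤ C := by
    have h := (abs_nonneg _).trans (hC 2 le_rfl)
    exact le_of_not_gt fun hneg ↦ by
      linarith [mul_neg_of_neg_of_pos hneg (Real.exp_pos (-c * Real.sqrt (Real.log 2)))]
  refine ⟨max (C * K) 1, by positivity, fun e he ↦ ?_⟩
  rcases eq_or_lt_of_le he with rfl | he2
  · simp only [Icc_self, sum_singleton, Nat.cast_one, ArithmeticFunction.moebius_apply_one,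
      Int.cast_one, div_one, abs_one, Real.log_one, add_zero, one_pow]
    exact le_max_right _ _
  · have he2' : (2 : ℝ) ≤ e := by exact_mod_cast he2
    have hL : 0 ≤ Real.log e := Real.log_nonneg (by linarith)
    have h := hC e he2'
    rw [Nat.floor_natCast, neg_mul] at h
    have hpow : 0 < (1 + Real.log e) ^ 13 := by positivity
    calc |∑ k ∈ Icc 1 e, (μ k : ℝ) / k| ≤ C * Real.exp (-(c * Real.sqrt (Real.log e))) := h
      _ ≤ C * (K / (1 + Real.log e) ^ 13) := mul_le_mul_of_nonneg_left (hKb _ hL) hC0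
      _ = C * K / (1 + Real.log e) ^ 13 := by ring
      _ ≤ max (C * K) 1 / (1 + Real.log e) ^ 13 :=
          div_le_div_of_nonneg_right (le_max_left _ _) hpow.le

/-- `y^{−1/16} ≪ (1 + log y)⁻¹²` for `y ≥ 1`. [folklore] -/
theorem rpow_neg_sixteenth_le_inv_log_pow :
    ∃ C : ℝ, 0 < C ∧ ∀ y : ℝ, 1 ≤ y → y ^ (-(1 / 16 : ℝ)) ≤ C / (1 + Real.log y) ^ 12 := by
  obtain ⟨K, hK, hKb⟩ := exp_neg_sqrt_le_div_pow (show (0 : ℝ) < 1 / 16 by norm_num) 12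
  refine ⟨Real.exp (1 / 16) * K, by positivity, fun y hy ↦ ?_⟩
  have hy0 : 0 < y := by linarith
  set L := Real.log y with hL
  have hL0 : 0 ≤ L := Real.log_nonneg hy
  have h1 : y ^ (-(1 / 16 : ℝ)) = Real.exp (-(L / 16)) := by
    rw [Real.rpow_def_of_pos hy0, ← hL]; ring_nf
  -- L/16 ≥ √L/16 − 1/16 since L − √L + 1 ≥ 0
  have h2 : -(L / 16) ≤ 1 / 16 + -(1 / 16 * Real.sqrt L) := by
    have hs : Real.sqrt L * Real.sqrt L = L := Real.mul_self_sqrt hL0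
    nlinarith [sq_nonneg (Real.sqrt L - 1), Real.sqrt_nonneg L]
  rw [h1]
  calc Real.exp (-(L / 16)) ≤ Real.exp (1 / 16 + -(1 / 16 * Real.sqrt L)) := Real.exp_le_exp.2 h2
    _ = Real.exp (1 / 16) * Real.exp (-(1 / 16 * Real.sqrt L)) := Real.exp_add _ _
    _ ≤ Real.exp (1 / 16) * (K / (1 + L) ^ 12) :=
        mul_le_mul_of_nonneg_left (hKb L hL0) (Real.exp_pos _).le
    _ = Real.exp (1 / 16) * K / (1 + L) ^ 12 := by ring

/-! ### The plain `1/ζ²` sum `MM(z) = Σ_{de ≤ z} μ(d)μ(e)/(de)` -/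

/-- Unfolding `Σ_{j ≤ z} (G∗G)(j)` over the hyperbola `de ≤ ⌊z⌋`. [folklore] -/
theorem sum_G_mul_G_eq_hyperbola (z : ℝ) :
    ∑ j ∈ Icc 1 ⌊z⌋₊, (G * G) j =
      ∑ d ∈ Ioc 0 ⌊z⌋₊, ∑ e ∈ Ioc 0 (⌊z⌋₊ / d), (μ d : ℝ) / d * ((μ e : ℝ) / e) := by
  rw [Icc_one_eq_Ioc_zero]
  have h1 : ∑ j ∈ Ioc 0 ⌊z⌋₊, (G * G) j =
      ∑ j ∈ Ioc 0 ⌊z⌋₊, ∑ x ∈ j.divisorsAntidiagonal, G x.1 * G x.2 := by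
    refine Finset.sum_congr rfl fun j _ ↦ ?_
    rw [mul_apply]
  rw [h1, SiegelWalfiszLiouville.sum_Ioc_sum_divisorsAntidiagonal_eq (fun a b ↦ G a * G b) ⌊z⌋₊]
  refine Finset.sum_congr rfl fun d _ ↦ Finset.sum_congr rfl fun e _ ↦ ?_
  rw [G_apply', G_apply']
  simp only [div_eq_mul_inv]

/-- **`|Σ_{de ≤ z} μ(d)μ(e)/(de)| ≤ C/(1 + log z)¹²` for `z ≥ 1`** (hyperbola at `u = ⌊√z⌋`: the box
is `m(u)²`, the tail is `2Σ_{d ≤ u} μ(d)d⁻¹(m(⌊z⌋/d) − m(u))`, and `m(e) = Σ_{k≤e} μ(k)/k ≪ (1+log e)⁻¹³`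
for `e ≥ u`, `1 + log u ≥ (1 + log z)/4`). [cite: MontgomeryVaughan2007, §8.1 (8.6) — derivation (hyperbola for 1/ζ²)] -/
theorem abs_moebiusSqSum_le :
    ∃ C : ℝ, 0 < C ∧ ∀ z : ℝ, 1 ≤ z →
      |∑ d ∈ Ioc 0 ⌊z⌋₊, ∑ e ∈ Ioc 0 (⌊z⌋₊ / d), (μ d : ℝ) / d * ((μ e : ℝ) / e)| ≤
        C / (1 + Real.log z) ^ 12 := by
  obtain ⟨C₀, hC₀, h0⟩ := abs_sum_moebius_div_le_inv_log_pow_thirteen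
  refine ⟨(C₀ * 4 ^ 13) ^ 2 + 16 * (C₀ * 4 ^ 13), by positivity, fun z hz ↦ ?_⟩
  have hz0 : 0 < z := by linarith
  set L : ℝ := Real.log z with hLdef
  have hL : 0 ≤ L := Real.log_nonneg hz
  obtain ⟨hu1, huu, hZu⟩ := floor_sqrt_facts hz
  set u : ℕ := ⌊Real.sqrt z⌋₊ with hudef
  set Z : ℕ := ⌊z⌋₊ with hZdef
  have hZz : (Z : ℝ) ≤ z := Nat.floor_le hz0.le
  have hu0 : (0 : ℝ) < u := by exact_mod_cast hu1
  have huuz : (u : ℝ) * u ≤ z := by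
    have : ((u * u : ℕ) : ℝ) ≤ Z := by exact_mod_cast huu
    push_cast at this; linarith
  have huz : (u : ℝ) ≤ z := by nlinarith
  have hlogu : (1 + L) / 4 ≤ 1 + Real.log (u : ℝ) := one_add_log_le_floor_sqrt hz
  have hloguL : Real.log (u : ℝ) ≤ L := Real.log_le_log hu0 huz
  -- uniform bound on `m(e)` for `e ≥ u`
  set m : ℕ → ℝ := fun e ↦ ∑ k ∈ Icc 1 e, (μ k : ℝ) / k with hmdef
  set η : ℝ := C₀ * 4 ^ 13 / (1 + L) ^ 13 with hηdef
  have hη0 : 0 ≤ η := by positivity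
  have hm0 : ∀ e : ℕ, u ≤ e → |m e| ≤ η := by
    intro e hue
    have he1 : 1 ≤ e := hu1.trans hue
    have hle : 1 + Real.log (u : ℝ) ≤ 1 + Real.log (e : ℝ) := by
      have := Real.log_le_log hu0 (show (u : ℝ) ≤ e by exact_mod_cast hue); linarith
    calc |m e| ≤ C₀ / (1 + Real.log (e : ℝ)) ^ 13 := h0 e he1
      _ ≤ C₀ / ((1 + L) / 4) ^ 13 := by
          apply div_le_div_of_nonneg_left hC₀.le (by positivity)
          exact pow_le_pow_left₀ (by positivity) (hlogu.trans hle) 13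
      _ = η := by rw [hηdef]; field_simp
  set g : ℕ → ℝ := fun n ↦ (μ n : ℝ) / n with hgdef
  have hgle : ∀ n : ℕ, |g n| ≤ (n : ℝ)⁻¹ := by
    intro n
    rcases Nat.eq_zero_or_pos n with rfl | hn
    · simp [hgdef]
    · rw [hgdef]; dsimp only
      rw [abs_div, abs_of_pos (by exact_mod_cast hn : (0 : ℝ) < n), div_eq_mul_inv]
      have : |(μ n : ℝ)| ≤ 1 := by exact_mod_cast ArithmeticFunction.abs_moebius_le_one
      exact mul_le_of_le_one_left (by positivity) this
  -- hyperbola split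
  have hsym := sum_hyperbola_symm (fun d e ↦ g d * g e) (fun d e ↦ by ring) huu hZu
  have hF : ∀ d e : ℕ, (μ d : ℝ) / d * ((μ e : ℝ) / e) = g d * g e := fun d e ↦ rfl
  simp only [hF]
  rw [hsym]
  -- the box equals `m(u)²`
  have hbox : ∑ d ∈ Ioc 0 u, ∑ e ∈ Ioc 0 u, g d * g e = m u * m u := by
    rw [Finset.sum_mul_sum, Icc_one_eq_Ioc_zero]
  -- the tail, term by term in `d`
  have htail : ∀ d ∈ Ioc 0 u, |∑ e ∈ Ioc u (Z / d), g d * g e| ≤ (d : ℝ)⁻¹ * (2 * η) := by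
    intro d hd
    have hd' := Finset.mem_Ioc.1 hd
    have huZd : u ≤ Z / d :=
      (Nat.le_div_iff_mul_le hd'.1).2 (le_trans (Nat.mul_le_mul_left u hd'.2) huu)
    have hsplit : ∑ e ∈ Ioc u (Z / d), g d * g e = g d * (m (Z / d) - m u) := by
      rw [← Finset.mul_sum]
      congr 1
      simp only [hmdef]
      rw [Icc_one_eq_Ioc_zero, Icc_one_eq_Ioc_zero, ← Finset.sum_Ioc_consecutive _ (Nat.zero_le u) huZd]
      ring
    rw [hsplit, abs_mul]
    refine mul_le_mul (hgle d) ?_ (abs_nonneg _) (by positivity)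
    calc |m (Z / d) - m u| ≤ |m (Z / d)| + |m u| := abs_sub _ _
      _ ≤ η + η := add_le_add (hm0 _ huZd) (hm0 _ le_rfl)
      _ = 2 * η := by ring
  have hharm : ∑ d ∈ Icc 1 u, ((d : ℝ))⁻¹ ≤ 1 + Real.log u := by
    have h := harmonic_le_one_add_log u
    simpa [harmonic_eq_sum_Icc, Rat.cast_sum, Rat.cast_inv, Rat.cast_natCast] using h
  have htail' : |∑ d ∈ Ioc 0 u, ∑ e ∈ Ioc u (Z / d), g d * g e| ≤ (1 + L) * (2 * η) := by
    refine (Finset.abs_sum_le_sum_abs _ _).trans ((Finset.sum_le_sum htail).trans ?_)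
    rw [← Finset.sum_mul, ← Icc_one_eq_Ioc_zero]
    calc (∑ d ∈ Icc 1 u, (d : ℝ)⁻¹) * (2 * η) ≤ (1 + Real.log (u : ℝ)) * (2 * η) :=
          mul_le_mul_of_nonneg_right hharm (by positivity)
      _ ≤ (1 + L) * (2 * η) := by gcongr
  have hmu : |m u| ≤ η := hm0 u le_rfl
  have h1L : 1 ≤ 1 + L := by linarith
  have hη1 : η ≤ C₀ * 4 ^ 13 / (1 + L) ^ 12 := by
    rw [hηdef]
    apply div_le_div_of_nonneg_left (by positivity) (by positivity)
    exact pow_le_pow_right₀ h1L (by norm_num)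
  have hη2 : η ≤ C₀ * 4 ^ 13 := by
    rw [hηdef]; exact div_le_self (by positivity) (one_le_pow₀ h1L)
  have hη3 : (1 + L) * η = C₀ * 4 ^ 13 / (1 + L) ^ 12 := by
    rw [hηdef]; field_simp
  calc |∑ d ∈ Ioc 0 u, ∑ e ∈ Ioc 0 u, g d * g e + 2 * ∑ d ∈ Ioc 0 u, ∑ e ∈ Ioc u (Z / d), g d * g e|
      ≤ |∑ d ∈ Ioc 0 u, ∑ e ∈ Ioc 0 u, g d * g e| +
          |2 * ∑ d ∈ Ioc 0 u, ∑ e ∈ Ioc u (Z / d), g d * g e| := abs_add_le _ _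
    _ ≤ η * η + 2 * ((1 + L) * (2 * η)) := by
        rw [hbox, abs_mul, abs_mul, abs_two]
        exact add_le_add (mul_le_mul hmu hmu (abs_nonneg _) hη0)
          (mul_le_mul_of_nonneg_left htail' zero_le_two)
    _ = η * η + 4 * ((1 + L) * η) := by ring
    _ ≤ (C₀ * 4 ^ 13) * (C₀ * 4 ^ 13 / (1 + L) ^ 12) + 4 * (C₀ * 4 ^ 13 / (1 + L) ^ 12) := by
        rw [hη3]
        exact add_le_add (mul_le_mul hη2 hη1 hη0 (by positivity)) le_rfl
    _ = ((C₀ * 4 ^ 13) ^ 2 + 4 * (C₀ * 4 ^ 13)) / (1 + L) ^ 12 := by ring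
    _ ≤ ((C₀ * 4 ^ 13) ^ 2 + 16 * (C₀ * 4 ^ 13)) / (1 + L) ^ 12 := by
        apply div_le_div_of_nonneg_right _ (by positivity)
        nlinarith [hC₀]

/-! ### The twisted coprime sum `A_n(y) = Σ_{k ≤ y} copTauW n k` -/

/-- **Dirichlet's rearrangement** `Σ_{k ≤ y} a_n(k) = Σ_{m ≤ y} h_n(m)·MM(y/m)` with `a_n = h_n ∗ (G∗G)`.
[cite: KowalskiMichelVanderKam2000, Prop. 5.1 — derivation] -/
theorem sum_copTauW_eq_sum_hloc (n : ℕ) (y : ℝ) :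
    ∑ k ∈ Icc 1 ⌊y⌋₊, copTauW n k = ∑ m ∈ Icc 1 ⌊y⌋₊, hloc n m *
      ∑ d ∈ Ioc 0 ⌊y / m⌋₊, ∑ e ∈ Ioc 0 (⌊y / m⌋₊ / d), (μ d : ℝ) / d * ((μ e : ℝ) / e) := by
  rw [copTauW_eq_G_mul_G_mul_hloc, mul_comm (G * G) (hloc n), Icc_one_eq_Ioc_zero]
  have h1 : ∑ k ∈ Ioc 0 ⌊y⌋₊, (hloc n * (G * G)) k =
      ∑ k ∈ Ioc 0 ⌊y⌋₊, ∑ x ∈ k.divisorsAntidiagonal, hloc n x.1 * (G * G) x.2 := by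
    refine Finset.sum_congr rfl fun k _ ↦ ?_
    rw [mul_apply]
  rw [h1, SiegelWalfiszLiouville.sum_Ioc_sum_divisorsAntidiagonal_eq
    (fun a b ↦ hloc n a * (G * G) b) ⌊y⌋₊]
  refine Finset.sum_congr rfl fun m hm ↦ ?_
  rw [← Finset.mul_sum, ← sum_G_mul_G_eq_hyperbola, Nat.floor_div_natCast, Icc_one_eq_Ioc_zero]

/-- For `1 ≤ m ≤ y`: `1/(1 + log(y/m))¹² ≤ m^{1/8}·(2¹²/(1 + log y)¹² + y^{−1/16})` (split at `m = √y`).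
[folklore] -/
theorem inv_log_pow_le_rpow_mul {y : ℝ} (hy : 1 ≤ y) {m : ℕ} (hm1 : 1 ≤ m) (hmy : (m : ℝ) ≤ y) :
    1 / (1 + Real.log (y / m)) ^ 12 ≤
      (m : ℝ) ^ (1 / 8 : ℝ) * ((2 : ℝ) ^ 12 / (1 + Real.log y) ^ 12 + y ^ (-(1 / 16 : ℝ))) := by
  have hy0 : 0 < y := by linarith
  have hm0 : (0 : ℝ) < m := by exact_mod_cast hm1
  have hm1' : (1 : ℝ) ≤ m := by exact_mod_cast hm1
  have hym : 1 ≤ y / m := by rw [le_div_iff₀ hm0]; linarith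
  have hL : 0 ≤ Real.log y := Real.log_nonneg hy
  have hLm : 0 ≤ Real.log (y / m) := Real.log_nonneg hym
  have hm8 : 1 ≤ (m : ℝ) ^ (1 / 8 : ℝ) := Real.one_le_rpow hm1' (by norm_num)
  have hA : 0 ≤ (2 : ℝ) ^ 12 / (1 + Real.log y) ^ 12 := by positivity
  have hB : 0 ≤ y ^ (-(1 / 16 : ℝ)) := by positivity
  rcases le_or_gt ((m : ℝ) ^ 2) y with hcase | hcase
  · -- m ≤ √y: log(y/m) ≥ ½ log y
    have hlog : Real.log y ≤ 2 * Real.log (y / m) := by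
      rw [Real.log_div hy0.ne' hm0.ne']
      have : 2 * Real.log m ≤ Real.log y := by
        have h2 : Real.log ((m : ℝ) ^ 2) = 2 * Real.log m := by
          rw [Real.log_pow]; norm_num
        rw [← h2]; exact Real.log_le_log (by positivity) hcase
      linarith
    have h1 : 1 + Real.log y ≤ 2 * (1 + Real.log (y / m)) := by linarith
    have h2 : 1 / (1 + Real.log (y / m)) ^ 12 ≤ (2 : ℝ) ^ 12 / (1 + Real.log y) ^ 12 := by
      rw [div_le_div_iff₀ (by positivity) (by positivity), one_mul, ← mul_pow]
      exact pow_le_pow_left₀ (by positivity) h1 12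
    calc 1 / (1 + Real.log (y / m)) ^ 12 ≤ (2 : ℝ) ^ 12 / (1 + Real.log y) ^ 12 := h2
      _ ≤ 1 * ((2 : ℝ) ^ 12 / (1 + Real.log y) ^ 12 + y ^ (-(1 / 16 : ℝ))) := by linarith
      _ ≤ (m : ℝ) ^ (1 / 8 : ℝ) * ((2 : ℝ) ^ 12 / (1 + Real.log y) ^ 12 + y ^ (-(1 / 16 : ℝ))) :=
          mul_le_mul_of_nonneg_right hm8 (by positivity)
  · -- m > √y: m^{1/8} y^{-1/16} ≥ 1
    have h1 : 1 / (1 + Real.log (y / m)) ^ 12 ≤ 1 := by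
      rw [div_le_one (by positivity)]
      exact one_le_pow₀ (by linarith)
    have h2 : 1 ≤ (m : ℝ) ^ (1 / 8 : ℝ) * y ^ (-(1 / 16 : ℝ)) := by
      have hy16 : y ^ (-(1 / 16 : ℝ)) = (y ^ (1 / 16 : ℝ))⁻¹ := Real.rpow_neg hy0.le _
      have hypos : 0 < y ^ (1 / 16 : ℝ) := by positivity
      rw [hy16, ← div_eq_mul_inv, le_div_iff₀ hypos, one_mul]
      have : y ^ (1 / 16 : ℝ) ≤ ((m : ℝ) ^ 2) ^ (1 / 16 : ℝ) :=
        Real.rpow_le_rpow hy0.le hcase.le (by norm_num)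
      refine this.trans (le_of_eq ?_)
      rw [← Real.rpow_natCast, ← Real.rpow_mul hm0.le]
      norm_num
    calc 1 / (1 + Real.log (y / m)) ^ 12 ≤ 1 := h1
      _ ≤ (m : ℝ) ^ (1 / 8 : ℝ) * y ^ (-(1 / 16 : ℝ)) := h2
      _ ≤ (m : ℝ) ^ (1 / 8 : ℝ) * ((2 : ℝ) ^ 12 / (1 + Real.log y) ^ 12 + y ^ (-(1 / 16 : ℝ))) := by
          apply mul_le_mul_of_nonneg_left _ (by positivity); linarith

/-- **`|A_n(y)| ≤ C·D(n)/(1 + log y)¹²`** for `y ≥ 1`, `n ≥ 1` — the twisted coprime sums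
`Σ_{k ≤ y, (k,n)=1} μ(k)τ(k)/(kψ(k))` tend to `0` at a power-of-log rate, uniformly in `n` up to the
divisor weight `D(n) = Σ_{d∣n} d^{−3/4}`.
[cite: MontgomeryVaughan2007, §8.1 (8.6) — derivation (twisted 1/ζ² partial sums, uniform in the coprimality modulus)] -/
theorem abs_sum_copTauW_le :
    ∃ C : ℝ, 0 < C ∧ ∀ n : ℕ, n ≠ 0 → ∀ y : ℝ, 1 ≤ y →
      |∑ k ∈ Icc 1 ⌊y⌋₊, copTauW n k| ≤ C * divWeight n / (1 + Real.log y) ^ 12 := by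
  obtain ⟨C_M, hC_M, hM⟩ := abs_moebiusSqSum_le
  obtain ⟨C_h, hC_h, hH⟩ := tsum_abs_hloc_mul_rpow_le
  obtain ⟨C₁₆, hC₁₆, h16⟩ := rpow_neg_sixteenth_le_inv_log_pow
  refine ⟨C_M * C_h * ((2 : ℝ) ^ 12 + C₁₆), by positivity, fun n hn y hy ↦ ?_⟩
  have hy0 : 0 < y := by linarith
  set N : ℕ := ⌊y⌋₊ with hN
  set L : ℝ := Real.log y with hLdef
  have hL : 0 ≤ L := Real.log_nonneg hy
  set D : ℝ := divWeight n with hDdef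
  have hD0 : 0 ≤ D := divWeight_nonneg n
  have hHn : ∑' m : ℕ, |hloc n m| * (m : ℝ) ^ (1 / 8 : ℝ) ≤ C_h * D := by
    have := hH n hn; simpa [hDdef, divWeight] using this
  have hsw := summable_abs_hloc_mul_rpow hn
  rw [sum_copTauW_eq_sum_hloc]
  -- termwise bound
  have hterm : ∀ m ∈ Icc 1 N, |hloc n m *
      ∑ d ∈ Ioc 0 ⌊y / m⌋₊, ∑ e ∈ Ioc 0 (⌊y / m⌋₊ / d), (μ d : ℝ) / d * ((μ e : ℝ) / e)| ≤
      (|hloc n m| * (m : ℝ) ^ (1 / 8 : ℝ)) * (C_M * ((2 : ℝ) ^ 12 / (1 + L) ^ 12 + y ^ (-(1 / 16 : ℝ)))) := by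
    intro m hm
    have hm' := Finset.mem_Icc.1 hm
    have hm0 : (0 : ℝ) < m := by exact_mod_cast hm'.1
    have hmy : (m : ℝ) ≤ y := le_trans (by exact_mod_cast hm'.2) (Nat.floor_le hy0.le)
    have hym : 1 ≤ y / m := by rw [le_div_iff₀ hm0]; linarith
    rw [abs_mul]
    have h1 := hM (y / m) hym
    have h2 := inv_log_pow_le_rpow_mul hy hm'.1 hmy
    calc |hloc n m| * |∑ d ∈ Ioc 0 ⌊y / m⌋₊, ∑ e ∈ Ioc 0 (⌊y / m⌋₊ / d), (μ d : ℝ) / d * ((μ e : ℝ) / e)|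
        ≤ |hloc n m| * (C_M / (1 + Real.log (y / m)) ^ 12) :=
          mul_le_mul_of_nonneg_left h1 (abs_nonneg _)
      _ = |hloc n m| * C_M * (1 / (1 + Real.log (y / m)) ^ 12) := by ring
      _ ≤ |hloc n m| * C_M *
          ((m : ℝ) ^ (1 / 8 : ℝ) * ((2 : ℝ) ^ 12 / (1 + L) ^ 12 + y ^ (-(1 / 16 : ℝ)))) :=
          mul_le_mul_of_nonneg_left h2 (by positivity)
      _ = (|hloc n m| * (m : ℝ) ^ (1 / 8 : ℝ)) *
          (C_M * ((2 : ℝ) ^ 12 / (1 + L) ^ 12 + y ^ (-(1 / 16 : ℝ)))) := by ring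
  have hfin : ∑ m ∈ Icc 1 N, |hloc n m| * (m : ℝ) ^ (1 / 8 : ℝ) ≤ C_h * D := by
    refine le_trans ?_ hHn
    exact hsw.sum_le_tsum _ (fun m _ ↦ by positivity)
  calc |∑ m ∈ Icc 1 N, hloc n m *
          ∑ d ∈ Ioc 0 ⌊y / m⌋₊, ∑ e ∈ Ioc 0 (⌊y / m⌋₊ / d), (μ d : ℝ) / d * ((μ e : ℝ) / e)|
      ≤ ∑ m ∈ Icc 1 N, |hloc n m *
          ∑ d ∈ Ioc 0 ⌊y / m⌋₊, ∑ e ∈ Ioc 0 (⌊y / m⌋₊ / d), (μ d : ℝ) / d * ((μ e : ℝ) / e)| :=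
        Finset.abs_sum_le_sum_abs _ _
    _ ≤ ∑ m ∈ Icc 1 N, (|hloc n m| * (m : ℝ) ^ (1 / 8 : ℝ)) *
          (C_M * ((2 : ℝ) ^ 12 / (1 + L) ^ 12 + y ^ (-(1 / 16 : ℝ)))) := Finset.sum_le_sum hterm
    _ = (∑ m ∈ Icc 1 N, |hloc n m| * (m : ℝ) ^ (1 / 8 : ℝ)) *
          (C_M * ((2 : ℝ) ^ 12 / (1 + L) ^ 12 + y ^ (-(1 / 16 : ℝ)))) := by rw [Finset.sum_mul]
    _ ≤ (C_h * D) * (C_M * ((2 : ℝ) ^ 12 / (1 + L) ^ 12 + C₁₆ / (1 + L) ^ 12)) := by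
        refine mul_le_mul hfin ?_ (by positivity) (by positivity)
        exact mul_le_mul_of_nonneg_left (by linarith [h16 y hy]) hC_M.le
    _ = C_M * C_h * ((2 : ℝ) ^ 12 + C₁₆) * D / (1 + L) ^ 12 := by
        field_simp

/-- **Uniform boundedness**: `|A_n(y)| ≤ C·D(n)` for `y ≥ 1`, `n ≥ 1`. [folklore] -/
theorem abs_sum_copTauW_le' :
    ∃ C : ℝ, 0 < C ∧ ∀ n : ℕ, n ≠ 0 → ∀ y : ℝ, 1 ≤ y →
      |∑ k ∈ Icc 1 ⌊y⌋₊, copTauW n k| ≤ C * divWeight n := by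
  obtain ⟨C, hC, h⟩ := abs_sum_copTauW_le
  refine ⟨C, hC, fun n hn y hy ↦ (h n hn y hy).trans ?_⟩
  have hL : 0 ≤ Real.log y := Real.log_nonneg hy
  exact div_le_self (by have := divWeight_nonneg n; positivity) (one_le_pow₀ (by linarith))

end Summit.Parity.GeneralizedHardyLittlewood.Theorems.BeyondDiagonalBeatsQuarter.Corner
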